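import Mathlib
import Literature.Analysis.PDE.GaussianBeam1DCutoff

/-!
# First-order Gaussian beams for `u_tt − u_xx + μ² q(x) u = 0`: majorants of the residual
# coefficients by sup norms (bookkeeping for `GaussianBeam1DEnergy.lean`)

Topic `Literature/Analysis/PDE` (namespace `Literature.Analysis.PDE`). Everything is proved; no
definitions. The `O(√μ)` pointwise bound of the beam residual (`norm_beam_residual_le`) has a
coefficient `M(t)` built from the phase functions at time `t`; on a compact time interval it is
bounded by the same expression in the sup norms (`beam_majorant_le`), and likewise the size of
`Φ_t` on the cut-off region (`beamPhase_t_norm_le`). Also: compactness helpers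
(`exists_norm_le_of_continuous_Icc`, `exists_pos_le_of_continuous_Icc`), the vanishing of the
derivatives of the cut-off off its transition annulus (`cutoff_derivs_eq_zero`) and the derivative
of the real part of a complex curve (`deriv_re_eq`). Elementary. [folklore]

## References

* J. Ralston, *Gaussian beams and the propagation of singularities*, MAA Stud. Math. 23 (1982)
  206–248, §2. Key `Ralston1982`.
-/

noncomputable section

namespace Literature.Analysis.PDE

open Set Filter Topology Complex

/-! ### Compactness helpers -/

/-- A continuous function is bounded in norm on `[a, b]`, by a non-negative constant. [folklore] -/
theorem exists_norm_le_of_continuous_Icc {E : Type*} [SeminormedAddCommGroup E] {f : ℝ → E}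
    (hf : Continuous f) (a b : ℝ) : ∃ C, 0 ≤ C ∧ ∀ t ∈ Icc a b, ‖f t‖ ≤ C := by
  obtain ⟨C, hC⟩ := isCompact_Icc.exists_bound_of_continuousOn (hf.continuousOn (s := Icc a b))
  exact ⟨max C 0, le_max_right _ _, fun t ht => (hC t ht).trans (le_max_left _ _)⟩

/-- A continuous positive function has a positive lower bound on `[a, b]`. [folklore] -/
theorem exists_pos_le_of_continuous_Icc {g : ℝ → ℝ} (hg : Continuous g) (hpos : ∀ t, 0 < g t)
    (a b : ℝ) : ∃ m, 0 < m ∧ ∀ t ∈ Icc a b, m ≤ g t := by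
  rcases le_or_gt a b with hab | hab
  · obtain ⟨t₀, ht₀, hmin⟩ := isCompact_Icc.exists_isMinOn (nonempty_Icc.2 hab)
      (hg.continuousOn (s := Icc a b))
    exact ⟨g t₀, hpos t₀, fun t ht => hmin ht⟩
  · exact ⟨1, one_pos, fun t ht => absurd (ht.1.trans ht.2) (not_le.2 hab)⟩

/-- A `C²` function which is constant `1` on `[−δ₀/2, δ₀/2]` and `0` on `{|y| ≥ δ₀}` has vanishing
first and second derivatives off the annulus `δ₀/2 ≤ |y| ≤ δ₀` (interior points of the level
sets). [folklore] -/
theorem cutoff_derivs_eq_zero {χ : ℝ → ℝ} {δ₀ : ℝ} (hχ1 : ∀ y ∈ Icc (-(δ₀ / 2)) (δ₀ / 2), χ y = 1)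
    (hχ0 : ∀ y, δ₀ ≤ |y| → χ y = 0) {y : ℝ} (hy : |y| < δ₀ / 2 ∨ δ₀ < |y|) :
    deriv χ y = 0 ∧ deriv (deriv χ) y = 0 := by
  -- `χ` is locally constant near `y`
  have hloc : ∃ c : ℝ, χ =ᶠ[𝓝 y] fun _ => c := by
    rcases hy with hy | hy
    · refine ⟨1, ?_⟩
      have hopen : IsOpen {z : ℝ | |z| < δ₀ / 2} := isOpen_lt continuous_abs continuous_const
      filter_upwards [hopen.mem_nhds hy] with z hz
      exact hχ1 z ⟨by linarith [neg_abs_le z, hz.le], (le_abs_self z).trans hz.le⟩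
    · refine ⟨0, ?_⟩
      have hopen : IsOpen {z : ℝ | δ₀ < |z|} := isOpen_lt continuous_const continuous_abs
      filter_upwards [hopen.mem_nhds hy] with z hz
      exact hχ0 z hz.le
  obtain ⟨c, hc⟩ := hloc
  have hd : deriv χ =ᶠ[𝓝 y] fun _ => 0 := by
    filter_upwards [eventually_eventually_nhds.2 hc] with z hz
    have hz' : χ =ᶠ[𝓝 z] fun _ => c := hz
    rw [hz'.deriv_eq, deriv_const]
  constructor
  · rw [hc.deriv_eq, deriv_const]
  · rw [hd.deriv_eq, deriv_const]

/-- Derivative of the real part of a differentiable complex curve. [folklore] -/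
theorem deriv_re_eq {f : ℝ → ℂ} {t : ℝ} (hf : DifferentiableAt ℝ f t) :
    deriv (fun s => (f s).re) t = (deriv f t).re := by
  rw [show (fun s => (f s).re) = Complex.reCLM ∘ f from rfl]
  exact ((Complex.reCLM.hasFDerivAt.comp_hasDerivAt t hf.hasDerivAt).congr_deriv (by simp)).deriv

/-! ### Majorants -/

/-- **The residual coefficient `M(t)` is bounded by the same expression in the sup norms.**
[folklore] -/
theorem beam_majorant_le {ξ₁ ξ₂ X₁ X₂ Γ₀ Γ₁ Γ₂ a₀ a₁ a₂ : ℂ}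
    {Cξ1 Cξ2 CX2 CΓ CΓ1 CΓ2 Ca Ca1 Ca2 Cq3 β βm : ℝ}
    (nξ1 : ‖ξ₁‖ ≤ Cξ1) (nξ2 : ‖ξ₂‖ ≤ Cξ2) (nX1 : ‖X₁‖ ≤ 1) (nX2 : ‖X₂‖ ≤ CX2)
    (nΓ : ‖Γ₀‖ ≤ CΓ) (nΓ1 : ‖Γ₁‖ ≤ CΓ1) (nΓ2 : ‖Γ₂‖ ≤ CΓ2) (na : ‖a₀‖ ≤ Ca) (na1 : ‖a₁‖ ≤ Ca1)
    (na2 : ‖a₂‖ ≤ Ca2) (hCq3 : 0 ≤ Cq3) (hβm0 : 0 < βm) (hβm : βm ≤ β) :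
    ‖a₀‖ * (‖ξ₁ - Γ₀ * X₁‖ * ‖Γ₁‖ + Cq3) * (16 / β ^ 2 + 2 / β) / 2
        + 4 * ‖a₀‖ * ‖Γ₁‖ ^ 2 / β ^ 2
        + ‖2 * (ξ₁ - Γ₀ * X₁) * a₁ + (ξ₂ - 2 * Γ₁ * X₁ - Γ₀ * X₂) * a₀‖ * (2 / β + 1) / 2
        + 2 * ‖Γ₁ * a₁ + Γ₂ / 2 * a₀‖ / β + ‖a₂‖
      ≤ Ca * ((Cξ1 + CΓ) * CΓ1 + Cq3) * (16 / βm ^ 2 + 2 / βm) / 2 + 4 * Ca * CΓ1 ^ 2 / βm ^ 2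
        + (2 * (Cξ1 + CΓ) * Ca1 + (Cξ2 + 2 * CΓ1 + CΓ * CX2) * Ca) * (2 / βm + 1) / 2
        + 2 * (CΓ1 * Ca1 + CΓ2 / 2 * Ca) / βm + Ca2 := by
  have hCΓ0 : 0 ≤ CΓ := (norm_nonneg _).trans nΓ
  have hCΓ10 : 0 ≤ CΓ1 := (norm_nonneg _).trans nΓ1
  have hCa0 : 0 ≤ Ca := (norm_nonneg _).trans na
  have hCa10 : 0 ≤ Ca1 := (norm_nonneg _).trans na1
  have hCξ10 : 0 ≤ Cξ1 := (norm_nonneg _).trans nξ1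
  have hCξ20 : 0 ≤ Cξ2 := (norm_nonneg _).trans nξ2
  have hCX20 : 0 ≤ CX2 := (norm_nonneg _).trans nX2
  have hCΓ20 : 0 ≤ CΓ2 := (norm_nonneg _).trans nΓ2
  have hβ : 0 < β := hβm0.trans_le hβm
  have hA1 : ‖ξ₁ - Γ₀ * X₁‖ ≤ Cξ1 + CΓ := by
    refine (norm_sub_le _ _).trans ?_
    rw [norm_mul]
    have p : ‖Γ₀‖ * ‖X₁‖ ≤ CΓ * 1 := mul_le_mul nΓ nX1 (norm_nonneg _) hCΓ0
    linarith only [nξ1, p]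
  have hS : ‖ξ₂ - 2 * Γ₁ * X₁ - Γ₀ * X₂‖ ≤ Cξ2 + 2 * CΓ1 + CΓ * CX2 := by
    have t1 := norm_sub_le (ξ₂ - 2 * Γ₁ * X₁) (Γ₀ * X₂)
    have t2 := norm_sub_le ξ₂ (2 * Γ₁ * X₁)
    refine t1.trans ((add_le_add t2 le_rfl).trans ?_)
    rw [norm_mul, norm_mul, Complex.norm_two, norm_mul]
    have p1 : ‖Γ₁‖ * ‖X₁‖ ≤ CΓ1 * 1 := mul_le_mul nΓ1 nX1 (norm_nonneg _) hCΓ10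
    have p2 : ‖Γ₀‖ * ‖X₂‖ ≤ CΓ * CX2 := mul_le_mul nΓ nX2 (norm_nonneg _) hCΓ0
    linarith only [nξ2, p1, p2]
  have hT1 : ‖2 * (ξ₁ - Γ₀ * X₁) * a₁ + (ξ₂ - 2 * Γ₁ * X₁ - Γ₀ * X₂) * a₀‖
      ≤ 2 * (Cξ1 + CΓ) * Ca1 + (Cξ2 + 2 * CΓ1 + CΓ * CX2) * Ca := by
    refine (norm_add_le _ _).trans ?_
    rw [norm_mul, norm_mul, Complex.norm_two, norm_mul]
    have p1 : ‖ξ₁ - Γ₀ * X₁‖ * ‖a₁‖ ≤ (Cξ1 + CΓ) * Ca1 :=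
      mul_le_mul hA1 na1 (norm_nonneg _) (by positivity)
    have p2 : ‖ξ₂ - 2 * Γ₁ * X₁ - Γ₀ * X₂‖ * ‖a₀‖ ≤ (Cξ2 + 2 * CΓ1 + CΓ * CX2) * Ca :=
      mul_le_mul hS na (norm_nonneg _) (by positivity)
    linarith only [p1, p2]
  have hT2 : ‖Γ₁ * a₁ + Γ₂ / 2 * a₀‖ ≤ CΓ1 * Ca1 + CΓ2 / 2 * Ca := by
    refine (norm_add_le _ _).trans ?_
    rw [norm_mul, norm_mul, norm_div, Complex.norm_two]
    have p1 : ‖Γ₁‖ * ‖a₁‖ ≤ CΓ1 * Ca1 := mul_le_mul nΓ1 na1 (norm_nonneg _) hCΓ10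
    have p2 : ‖Γ₂‖ / 2 * ‖a₀‖ ≤ CΓ2 / 2 * Ca :=
      mul_le_mul (by linarith only [nΓ2]) na (norm_nonneg _) (by positivity)
    linarith only [p1, p2]
  have hβi : 1 / β ≤ 1 / βm := one_div_le_one_div_of_le hβm0 hβm
  have hβi2 : 1 / β ^ 2 ≤ 1 / βm ^ 2 := by
    apply one_div_le_one_div_of_le (by positivity)
    exact pow_le_pow_left₀ hβm0.le hβm 2
  have i16 : 16 / β ^ 2 + 2 / β ≤ 16 / βm ^ 2 + 2 / βm := by
    have e1 : 16 / β ^ 2 ≤ 16 / βm ^ 2 := by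
      rw [div_eq_mul_one_div, div_eq_mul_one_div (16:ℝ)]; exact mul_le_mul_of_nonneg_left hβi2 (by norm_num)
    have e2 : 2 / β ≤ 2 / βm := by
      rw [div_eq_mul_one_div, div_eq_mul_one_div (2:ℝ)]; exact mul_le_mul_of_nonneg_left hβi (by norm_num)
    linarith only [e1, e2]
  have i21 : 2 / β + 1 ≤ 2 / βm + 1 := by
    have e2 : 2 / β ≤ 2 / βm := by
      rw [div_eq_mul_one_div, div_eq_mul_one_div (2:ℝ)]; exact mul_le_mul_of_nonneg_left hβi (by norm_num)
    linarith only [e2]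
  have q1 : ‖a₀‖ * (‖ξ₁ - Γ₀ * X₁‖ * ‖Γ₁‖ + Cq3) * (16 / β ^ 2 + 2 / β) / 2
      ≤ Ca * ((Cξ1 + CΓ) * CΓ1 + Cq3) * (16 / βm ^ 2 + 2 / βm) / 2 := by
    have i1 : ‖ξ₁ - Γ₀ * X₁‖ * ‖Γ₁‖ + Cq3 ≤ (Cξ1 + CΓ) * CΓ1 + Cq3 :=
      add_le_add (mul_le_mul hA1 nΓ1 (norm_nonneg _) (by positivity)) le_rfl
    have i2 := mul_le_mul na i1 (by positivity) hCa0
    have i3 := mul_le_mul i2 i16 (by positivity) (by positivity)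
    linarith only [i3]
  have q2 : 4 * ‖a₀‖ * ‖Γ₁‖ ^ 2 / β ^ 2 ≤ 4 * Ca * CΓ1 ^ 2 / βm ^ 2 := by
    have i1 : ‖Γ₁‖ ^ 2 ≤ CΓ1 ^ 2 := pow_le_pow_left₀ (norm_nonneg _) nΓ1 2
    have i2 := mul_le_mul na i1 (by positivity) hCa0
    have i3 := mul_le_mul i2 hβi2 (by positivity) (by positivity)
    have e1 : 4 * ‖a₀‖ * ‖Γ₁‖ ^ 2 / β ^ 2 = 4 * (‖a₀‖ * ‖Γ₁‖ ^ 2 * (1 / β ^ 2)) := by ring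
    have e2 : 4 * Ca * CΓ1 ^ 2 / βm ^ 2 = 4 * (Ca * CΓ1 ^ 2 * (1 / βm ^ 2)) := by ring
    rw [e1, e2]
    linarith only [i3]
  have q3 : ‖2 * (ξ₁ - Γ₀ * X₁) * a₁ + (ξ₂ - 2 * Γ₁ * X₁ - Γ₀ * X₂) * a₀‖ * (2 / β + 1) / 2
      ≤ (2 * (Cξ1 + CΓ) * Ca1 + (Cξ2 + 2 * CΓ1 + CΓ * CX2) * Ca) * (2 / βm + 1) / 2 := by
    have i3 := mul_le_mul hT1 i21 (by positivity) (by positivity)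
    linarith only [i3]
  have q4 : 2 * ‖Γ₁ * a₁ + Γ₂ / 2 * a₀‖ / β ≤ 2 * (CΓ1 * Ca1 + CΓ2 / 2 * Ca) / βm := by
    have i3 := mul_le_mul hT2 hβi (by positivity) (by positivity)
    have e1 : 2 * ‖Γ₁ * a₁ + Γ₂ / 2 * a₀‖ / β = 2 * (‖Γ₁ * a₁ + Γ₂ / 2 * a₀‖ * (1 / β)) := by ring
    have e2 : 2 * (CΓ1 * Ca1 + CΓ2 / 2 * Ca) / βm = 2 * ((CΓ1 * Ca1 + CΓ2 / 2 * Ca) * (1 / βm)) := by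
      ring
    rw [e1, e2]
    linarith only [i3]
  linarith only [q1, q2, q3, q4, na2]

/-- **Size of `Φ_t = θ′ + ξ′y − ξX′ + ½Γ′y² − ΓyX′` on `|y| ≤ δ₀`** in terms of sup norms.
[folklore] -/
theorem beamPhase_t_norm_le {θ₁ ξ₁ ξ₀ X₁ Γ₀ Γ₁ y : ℂ} {Cθ1 Cξ1 Cξ CΓ CΓ1 δ₀ : ℝ}
    (nθ1 : ‖θ₁‖ ≤ Cθ1) (nξ1 : ‖ξ₁‖ ≤ Cξ1) (nξ : ‖ξ₀‖ ≤ Cξ) (nX1 : ‖X₁‖ ≤ 1) (nΓ : ‖Γ₀‖ ≤ CΓ)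
    (nΓ1 : ‖Γ₁‖ ≤ CΓ1) (ny : ‖y‖ ≤ δ₀) :
    ‖θ₁ + ξ₁ * y - ξ₀ * X₁ + Γ₁ / 2 * y ^ 2 - Γ₀ * y * X₁‖
      ≤ Cθ1 + Cξ1 * δ₀ + Cξ + CΓ1 / 2 * δ₀ ^ 2 + CΓ * δ₀ := by
  have hCξ0 : 0 ≤ Cξ := (norm_nonneg _).trans nξ
  have hCΓ0 : 0 ≤ CΓ := (norm_nonneg _).trans nΓ
  have hδ : 0 ≤ δ₀ := (norm_nonneg _).trans ny
  have e2 : ‖ξ₁ * y‖ ≤ Cξ1 * δ₀ := by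
    rw [norm_mul]; exact mul_le_mul nξ1 ny (norm_nonneg _) ((norm_nonneg _).trans nξ1)
  have e3 : ‖ξ₀ * X₁‖ ≤ Cξ := by
    rw [norm_mul]
    have := mul_le_mul nξ nX1 (norm_nonneg _) hCξ0
    linarith only [this]
  have e4 : ‖Γ₁ / 2 * y ^ 2‖ ≤ CΓ1 / 2 * δ₀ ^ 2 := by
    rw [norm_mul, norm_div, Complex.norm_two, norm_pow]
    exact mul_le_mul (by linarith only [nΓ1]) (pow_le_pow_left₀ (norm_nonneg _) ny 2)
      (by positivity) (by linarith only [(norm_nonneg _).trans nΓ1])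
  have e5 : ‖Γ₀ * y * X₁‖ ≤ CΓ * δ₀ := by
    rw [norm_mul, norm_mul]
    have h1 : ‖Γ₀‖ * ‖y‖ ≤ CΓ * δ₀ := mul_le_mul nΓ ny (norm_nonneg _) hCΓ0
    have h2 := mul_le_mul h1 nX1 (norm_nonneg _) (by positivity)
    linarith only [h2]
  have t1 := norm_sub_le (θ₁ + ξ₁ * y - ξ₀ * X₁ + Γ₁ / 2 * y ^ 2) (Γ₀ * y * X₁)
  have t2 := norm_add_le (θ₁ + ξ₁ * y - ξ₀ * X₁) (Γ₁ / 2 * y ^ 2)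
  have t3 := norm_sub_le (θ₁ + ξ₁ * y) (ξ₀ * X₁)
  have t4 := norm_add_le θ₁ (ξ₁ * y)
  linarith only [t1, t2, t3, t4, nθ1, e2, e3, e4, e5]

end Literature.Analysis.PDE
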